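import Summits.CriticalPhenomena.PercolationContinuityZ3.Theorems.PercNearOneGluingNoHeavyLowerTailKnQuestion8CoefficientwisePendantEdge
import HarnessLib

/-!
# NO-CORE at a degree-two vertex follows from the two-point exclusion on `G − y` (the degree-two reduction, in the kernel) — prim-lf-2 gen 48, part 2 of 2

Support file (`--supports stmt-CriticalPhenomena-4575`, closed), prover `prim-lf-2` (gen 48).  No definitions, no named facts, no sorries; standard axioms.
Memo `prim-lf-2/CW-HT-gen48.md` §3; the identity is CW-BOX-gen46 §2(d) / CW-QMIX-gen47 §0: for a vertex `y` of degree two with neighbours `p, q`,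
  `NO-CORE(y) = H(G − y + pq) + Q_mix^{G−y}(p,q) + Q_mix^{G−y}(q,p)`   (here the first term appears as the same-colour Harris part of part 1).

Setting.  Finite multigraph `ends : ι → Sym2 V`, root `x`; colourings `s : Finset ι` (red) / `sᶜ` (blue); `K(s) = openCluster (ends '' s) x`; `NO-CORE(y) = Σ_{s : ¬(y ∈ K s ∧ y ∈ K sᶜ)} f̂ ĝ`.
The vertex `y ∉ {x, p, q}` has exactly two edges `i₁` (to `p`) and `i₂` (to `q`); `f, g` are monotone and ignore `y` (`f (insert y C) = f C`).
* `noCore_degTwo_split` — the colourings with `y` not doubly reached = (same colour on `i₁,i₂`) ⊔ (`i₁` red, `i₂` blue, not doubly reached) ⊔ (`i₁` blue, `i₂` red, …);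
* `noCore_degTwo_nonneg_of_qmix` — REDUCTION THEOREM: if the two `G − y` exclusions `Q_mix(p,q)`, `Q_mix(q,p)` (sums over the cube of the edges `≠ i₁, i₂`) are `≥ 0` then
  `NO-CORE(y) ≥ 0` (part 1's `sameColour_part_nonneg` + `redBlue_part_eq` twice).  Every Q_mix theorem of gens 47–48 (dominated, root-pendant, the two Harris-twice classes)
  thus becomes a NO-CORE theorem at degree-two vertices;
* `noCore_degTwo_adj_point_nonneg` — COROLLARY with `qmix_nonneg_of_pointIndicator` / `_right`: for `f = 1[p ∈ ·]` (the POINT `p` adjacent to `y`) and every monotone `g`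
  ignoring `y`, `NO-CORE(y) ≥ 0` on every multigraph — the first settled position of CONJECTURE NO-CORE with `y` at distance two from the root beside a point
  (memo CW-QMIX-gen47 §2 named it the first open position; gen 47's `qmix_points_nonneg` gave only `N(y) = {u,w}`).
[cite: KozmaNitzan2024, Questions 8–9 (§5.5 p. 36) (context: the Question-8 pocket covariance programme)]
-/

namespace Summit.CriticalPhenomena.PercolationContinuityZ3.Theorems

open Finset Literature.Probability.Percolation

namespace Coefficientwise

variable {ι V : Type*} [Fintype ι] [DecidableEq ι] (ends : ι → Sym2 V) (x : V)
variable {y p q : V} {i₁ i₂ : ι} (f g : Set V → ℝ)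

open Classical in
/-- **The three-part split of NO-CORE at a degree-two vertex.**  With `y ∉ {x}` of degree two (edges `i₁ ≠ i₂`), the colourings with `y` not doubly reached are:
all colourings giving `i₁, i₂` the same colour, plus those with `i₁` red / `i₂` blue resp. `i₁` blue / `i₂` red and `y` not doubly reached.
[cite: KozmaNitzan2024, Questions 8–9 (§5.5 p. 36) (context)] -/
theorem noCore_degTwo_split (hne : i₁ ≠ i₂) (hdeg : ∀ i, y ∈ ends i → i = i₁ ∨ i = i₂) (hxy : x ≠ y) (Φ : Finset ι → ℝ) :
    ∑ s ∈ univ.filter (fun s : Finset ι =>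
        ¬ (y ∈ openCluster (ends '' (↑s : Set ι)) x ∧ y ∈ openCluster (ends '' (↑(sᶜ) : Set ι)) x)), Φ s =
    ∑ s ∈ univ.filter (fun s : Finset ι => (i₁ ∈ s ↔ i₂ ∈ s)), Φ s +
    ∑ s ∈ univ.filter (fun s : Finset ι => i₁ ∈ s ∧ i₂ ∉ s ∧
        ¬ (y ∈ openCluster (ends '' (↑s : Set ι)) x ∧ y ∈ openCluster (ends '' (↑(sᶜ) : Set ι)) x)), Φ s +
    ∑ s ∈ univ.filter (fun s : Finset ι => i₂ ∈ s ∧ i₁ ∉ s ∧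
        ¬ (y ∈ openCluster (ends '' (↑s : Set ι)) x ∧ y ∈ openCluster (ends '' (↑(sᶜ) : Set ι)) x)), Φ s := by
  set K : Finset ι → Set V := fun s => openCluster (ends '' (↑s : Set ι)) x with hK
  have hnoy : ∀ s : Finset ι, i₁ ∉ s → i₂ ∉ s → y ∉ K s := fun s h1 h2 =>
    not_mem_openCluster_of_no_edge ends x s hxy (fun i hi hyi => by
      rcases hdeg i hyi with rfl | rfl
      · exact h1 hi
      · exact h2 hi)
  have hpt : ∀ s : Finset ι, (if ¬ (y ∈ K s ∧ y ∈ K sᶜ) then Φ s else 0) =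
      (if (i₁ ∈ s ↔ i₂ ∈ s) then Φ s else 0) + (if (i₁ ∈ s ∧ i₂ ∉ s ∧ ¬ (y ∈ K s ∧ y ∈ K sᶜ)) then Φ s else 0) +
        (if (i₂ ∈ s ∧ i₁ ∉ s ∧ ¬ (y ∈ K s ∧ y ∈ K sᶜ)) then Φ s else 0) := by
    intro s
    by_cases h1 : i₁ ∈ s <;> by_cases h2 : i₂ ∈ s
    · have : y ∉ K sᶜ := hnoy sᶜ (by simpa using h1) (by simpa using h2)
      simp [h1, h2, this]
    · simp [h1, h2]
    · simp [h1, h2]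
    · have : y ∉ K s := hnoy s h1 h2
      simp [h1, h2, this]
  change ∑ s ∈ univ.filter (fun s : Finset ι => ¬ (y ∈ K s ∧ y ∈ K sᶜ)), Φ s =
    ∑ s ∈ univ.filter (fun s : Finset ι => (i₁ ∈ s ↔ i₂ ∈ s)), Φ s +
    ∑ s ∈ univ.filter (fun s : Finset ι => i₁ ∈ s ∧ i₂ ∉ s ∧ ¬ (y ∈ K s ∧ y ∈ K sᶜ)), Φ s +
    ∑ s ∈ univ.filter (fun s : Finset ι => i₂ ∈ s ∧ i₁ ∉ s ∧ ¬ (y ∈ K s ∧ y ∈ K sᶜ)), Φ s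
  rw [Finset.sum_filter, Finset.sum_filter, Finset.sum_filter, Finset.sum_filter,
    Finset.sum_congr rfl (fun s _ => hpt s), Finset.sum_add_distrib, Finset.sum_add_distrib]

open Classical in
/-- **REDUCTION THEOREM: NO-CORE at a degree-two vertex follows from the two-point exclusion on `G − y`.**  Let `y ∉ {x, p, q}` have exactly the two edges `i₁ = yp`,
`i₂ = yq`, and let the monotone `f, g` ignore `y`.  If the two `G − y` exclusions `Q_mix(p,q)` and `Q_mix(q,p)` (sums over the cube of the edges `≠ i₁, i₂`) are `≥ 0`, then
`0 ≤ NO-CORE(y) = Σ_{s : ¬(y ∈ K s ∧ y ∈ K sᶜ)} (f(K s) − f(K sᶜ))(g(K s) − g(K sᶜ))`.  (Same-colour part: `sameColour_part_nonneg`; mixed parts: `redBlue_part_eq` twice.)  Every Q_mix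
theorem of the lineage (`qmix_nonneg_of_dominated`, `qmix_nonneg_of_rootPendant`, `qmix_nonneg_of_pointIndicator`, `qmix_nonneg_of_needsBoth`, …) thus becomes a NO-CORE theorem
at degree-two vertices.  [cite: KozmaNitzan2024, Questions 8–9 (§5.5 p. 36) (context)] -/
theorem noCore_degTwo_nonneg_of_qmix (hi₁ : ends i₁ = s(y, p)) (hi₂ : ends i₂ = s(y, q)) (hne : i₁ ≠ i₂)
    (hdeg : ∀ i, y ∈ ends i → i = i₁ ∨ i = i₂) (hpy : p ≠ y) (hqy : q ≠ y) (hxy : x ≠ y)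
    (hf : Monotone f) (hg : Monotone g) (hfy : ∀ C : Set V, f (insert y C) = f C) (hgy : ∀ C : Set V, g (insert y C) = g C)
    (hQpq : 0 ≤ ∑ t ∈ univ.filter (fun t : Finset {j : ι // j ≠ i₁ ∧ j ≠ i₂} =>
        ¬ (p ∈ openCluster ((fun j : {j : ι // j ≠ i₁ ∧ j ≠ i₂} => ends j.1) '' (↑t : Set {j : ι // j ≠ i₁ ∧ j ≠ i₂})) x ∧
           q ∈ openCluster ((fun j : {j : ι // j ≠ i₁ ∧ j ≠ i₂} => ends j.1) '' (↑(tᶜ) : Set {j : ι // j ≠ i₁ ∧ j ≠ i₂})) x)),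
      (f (openCluster ((fun j : {j : ι // j ≠ i₁ ∧ j ≠ i₂} => ends j.1) '' (↑t : Set {j : ι // j ≠ i₁ ∧ j ≠ i₂})) x) -
          f (openCluster ((fun j : {j : ι // j ≠ i₁ ∧ j ≠ i₂} => ends j.1) '' (↑(tᶜ) : Set {j : ι // j ≠ i₁ ∧ j ≠ i₂})) x)) *
        (g (openCluster ((fun j : {j : ι // j ≠ i₁ ∧ j ≠ i₂} => ends j.1) '' (↑t : Set {j : ι // j ≠ i₁ ∧ j ≠ i₂})) x) -
          g (openCluster ((fun j : {j : ι // j ≠ i₁ ∧ j ≠ i₂} => ends j.1) '' (↑(tᶜ) : Set {j : ι // j ≠ i₁ ∧ j ≠ i₂})) x)))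
    (hQqp : 0 ≤ ∑ t ∈ univ.filter (fun t : Finset {j : ι // j ≠ i₁ ∧ j ≠ i₂} =>
        ¬ (q ∈ openCluster ((fun j : {j : ι // j ≠ i₁ ∧ j ≠ i₂} => ends j.1) '' (↑t : Set {j : ι // j ≠ i₁ ∧ j ≠ i₂})) x ∧
           p ∈ openCluster ((fun j : {j : ι // j ≠ i₁ ∧ j ≠ i₂} => ends j.1) '' (↑(tᶜ) : Set {j : ι // j ≠ i₁ ∧ j ≠ i₂})) x)),
      (f (openCluster ((fun j : {j : ι // j ≠ i₁ ∧ j ≠ i₂} => ends j.1) '' (↑t : Set {j : ι // j ≠ i₁ ∧ j ≠ i₂})) x) -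
          f (openCluster ((fun j : {j : ι // j ≠ i₁ ∧ j ≠ i₂} => ends j.1) '' (↑(tᶜ) : Set {j : ι // j ≠ i₁ ∧ j ≠ i₂})) x)) *
        (g (openCluster ((fun j : {j : ι // j ≠ i₁ ∧ j ≠ i₂} => ends j.1) '' (↑t : Set {j : ι // j ≠ i₁ ∧ j ≠ i₂})) x) -
          g (openCluster ((fun j : {j : ι // j ≠ i₁ ∧ j ≠ i₂} => ends j.1) '' (↑(tᶜ) : Set {j : ι // j ≠ i₁ ∧ j ≠ i₂})) x))) :
    0 ≤ ∑ s ∈ univ.filter (fun s : Finset ι =>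
        ¬ (y ∈ openCluster (ends '' (↑s : Set ι)) x ∧ y ∈ openCluster (ends '' (↑(sᶜ) : Set ι)) x)),
      (f (openCluster (ends '' (↑s : Set ι)) x) - f (openCluster (ends '' (↑(sᶜ) : Set ι)) x)) *
        (g (openCluster (ends '' (↑s : Set ι)) x) - g (openCluster (ends '' (↑(sᶜ) : Set ι)) x)) := by
  rw [noCore_degTwo_split ends x hne hdeg hxy,
    redBlue_part_eq ends x f g (fun j : ι => j ≠ i₁ ∧ j ≠ i₂) (fun j => Iff.rfl) hi₁ hi₂ hne hdeg hpy hqy hxy hfy hgy,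
    redBlue_part_eq ends x f g (fun j : ι => j ≠ i₁ ∧ j ≠ i₂) (fun j => and_comm) hi₂ hi₁ hne.symm
      (fun i hi => (hdeg i hi).symm) hqy hpy hxy hfy hgy]
  have hA := sameColour_part_nonneg ends x f g hne hf hg
  exact add_nonneg (add_nonneg hA hQpq) hQqp

open Classical in
/-- **COROLLARY: NO-CORE(y) ≥ 0 for a degree-two vertex `y` adjacent to the point.**  If `y ∉ {x}` has exactly two edges, to `p ≠ y` and to `q ≠ y`, then for `f = 1[p ∈ ·]`
and every monotone `g` ignoring `y`:  `0 ≤ Σ_{s : ¬(y ∈ K s ∧ y ∈ K sᶜ)} ([p ∈ K s] − [p ∈ K sᶜ])(g(K s) − g(K sᶜ))` — by the reduction theorem and the Harris-twice theorems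
`qmix_nonneg_of_pointIndicator` (for `Q_mix(p,q)`) and `qmix_nonneg_of_pointIndicator_right` (for `Q_mix(q,p)`) on `G − y`.  For the lineage's point functions: CONJECTURE
NO-CORE holds at every degree-two vertex adjacent to `u` or to `w`, whatever the rest of the multigraph (the first settled position at distance two from the root beside a point).
[cite: KozmaNitzan2024, Questions 8–9 (§5.5 p. 36) (context)] -/
theorem noCore_degTwo_adj_point_nonneg (hi₁ : ends i₁ = s(y, p)) (hi₂ : ends i₂ = s(y, q)) (hne : i₁ ≠ i₂)
    (hdeg : ∀ i, y ∈ ends i → i = i₁ ∨ i = i₂) (hpy : p ≠ y) (hqy : q ≠ y) (hxy : x ≠ y)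
    (hg : Monotone g) (hgy : ∀ C : Set V, g (insert y C) = g C) :
    0 ≤ ∑ s ∈ univ.filter (fun s : Finset ι =>
        ¬ (y ∈ openCluster (ends '' (↑s : Set ι)) x ∧ y ∈ openCluster (ends '' (↑(sᶜ) : Set ι)) x)),
      ((if p ∈ openCluster (ends '' (↑s : Set ι)) x then (1 : ℝ) else 0) - (if p ∈ openCluster (ends '' (↑(sᶜ) : Set ι)) x then (1 : ℝ) else 0)) *
        (g (openCluster (ends '' (↑s : Set ι)) x) - g (openCluster (ends '' (↑(sᶜ) : Set ι)) x)) := by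
  have hfm : Monotone (fun C : Set V => if p ∈ C then (1 : ℝ) else 0) := fun A B hAB => by
    by_cases hA : p ∈ A
    · simp [hA, hAB hA]
    · simp only [hA, if_false]; split_ifs <;> norm_num
  have hfy : ∀ C : Set V, (fun C : Set V => if p ∈ C then (1 : ℝ) else 0) (insert y C) = (fun C : Set V => if p ∈ C then (1 : ℝ) else 0) C :=
    fun C => by simp [Set.mem_insert_iff, hpy]
  exact noCore_degTwo_nonneg_of_qmix ends x (fun C : Set V => if p ∈ C then (1 : ℝ) else 0) g hi₁ hi₂ hne hdeg hpy hqy hxy hfm hg hfy hgy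
    (qmix_nonneg_of_pointIndicator (fun j : {j : ι // j ≠ i₁ ∧ j ≠ i₂} => ends j.1) x p q g hg)
    (qmix_nonneg_of_pointIndicator_right (fun j : {j : ι // j ≠ i₁ ∧ j ≠ i₂} => ends j.1) x q p g hg)

end Coefficientwise

end Summit.CriticalPhenomena.PercolationContinuityZ3.Theorems
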